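import Summits.CriticalPhenomena.CardyFormulaZ2.Theorems.CardyMagicRigidityNestingRigidityTomographyVocab
import Summits.CriticalPhenomena.CardyFormulaZ2.Theorems.CardyMagicRigidityNestingRigidityNeckCoarseZ2Surrogate
import Literature.Probability.Percolation.AnnulusCrossingBoundProofs
import Literature.Probability.Percolation.FiniteClustersPercolationOneArm
import HarnessLib

/-!
# Exterior-determinedness of the `ℤ²` neck-tomography objects: selection, glued partitions, pinned unambiguity

Crux `Summit.CriticalPhenomena.CardyFormulaZ2.Theses.CardyMagicRigidity.NestingRigidity` (stmt-CriticalPhenomena-4835),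
line `pinch-resampling` v4, stub S10' `stub_neckTomographyV4` (`FiveArmUpperT → FiveArmUpperZ2 → NoNeckRigidity →
NeckHookupCoarseT → NeckHookupCoarseZ2 → LoopLimitZ2Blind → LoopLimitZ2EqT`).  The `ℤ²` (bond) twin of §4 of the
vocabulary module `…NestingRigidityTomographyVocab` (p160054), typing note `S10p-typing-v2.md` item A7 (context events
of the identification step on `ℤ²`):

* §1 geometry (`zBall_mono` of S12's `…NeckCoarseZ2Surrogate` is reused): pairs of a vertex set avoiding the box `Λ_n(x)` are exterior pairs (`zExtEdges x n`); pairs whose DUAL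
  pair lies in a dual-vertex set avoiding the dual box `zDualBall x n` are exterior pairs (`not_mem_zBall_of_dualEdge`
  of S12's `…NeckCoarseZ2Locality`); the dual configurations of two configurations agreeing on `dualEdge ⁻¹' F` agree
  on `F`.
* §2 `exterior_agree_z2`: if `ω, ω'` agree on the exterior pairs of `Λ_{sc x}(x)` and the enlarged closed collars
  `Λ_{2 sc y + 1}(y)` of the other candidate centres avoid `Λ_{sc x + 1}(x)` (design condition; the `+1` absorbs the
  half-integer offset of the dual boxes), then the selected sets `zSel` agree, the realised states `zState` agree off
  `x`, and — if `x` is selected — both glued partitions `zGlueP`, `zGlueD` agree for every state vector.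
* §3 **`zUnambiguousIf_determinedBy` (registered anchor)**: the pinned event "`x` selected and unambiguous if its
  state is `β`" is determined by the exterior pairs `zExtEdges x (sc x)` — the form in which the `ℤ²` identification
  (`abs_real_zFourStrands_inter_zHookR_sub_integral_le`) takes its context events.

Sorry-free; no `Prop` definition is introduced.
-/

noncomputable section

namespace Summit.CriticalPhenomena.CardyFormulaZ2.Cruxes.NestingRigidity.PinchResampling

open Summit.CriticalPhenomena.CardyFormulaZ2.Theses.CardyMagicRigidity
open MeasureTheory Set Relation Literature.Probability.Percolation Literature.Probability.LatticeModels
  Literature.Probability.RandomPlanarGeometry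
open ZPinchLocality NeckCoarseZ2

/-! ## §1 Geometry of exterior pairs -/

section Geometry

/-- Pairs of a vertex set avoiding the box `Λ_n(x)` are exterior pairs of the box. -/
theorem sym2_subset_zExtEdges_of_disjoint {A : Set (Site 2)} {x : Site 2} {n : ℕ} (h : Disjoint A (zBall x n)) :
    A.sym2 ⊆ zExtEdges x n :=
  fun _ he _ hv ↦ Set.disjoint_left.1 h (Set.mem_sym2_iff_subset.1 he hv)

/-- Pairs whose dual pair lies in a dual-vertex set avoiding the dual box `zDualBall x n` are exterior pairs. -/
theorem preimage_dualEdge_sym2_subset_zExtEdges {A : Set (Site 2)} {x : Site 2} {n : ℕ}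
    (h : Disjoint A (zDualBall x n)) : dualEdge ⁻¹' A.sym2 ⊆ zExtEdges x n :=
  fun _ he ↦ not_mem_zBall_of_dualEdge fun _ hu ↦ Set.disjoint_left.1 h (Set.mem_sym2_iff_subset.1 he hu)

/-- **Dual configurations agree on `F` when the configurations agree on `dualEdge ⁻¹' F`.** -/
theorem dualConfig_inter_eq_of_inter_preimage_eq {ω ω' : BondConfig (Site 2)} {F : Set (Sym2 (Site 2))}
    (h : ω ∩ dualEdge ⁻¹' F = ω' ∩ dualEdge ⁻¹' F) : dualConfig ω ∩ F = dualConfig ω' ∩ F := by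
  have hA : DeterminedBy {η : BondConfig (Site 2) | η ∩ F = dualConfig ω ∩ F} F := by
    rw [determinedBy_iff]
    intro η η' hη
    simp only [mem_setOf_eq, hη]
  have key := (determinedBy_iff _ _).1 hA.preimage_dualConfig ω ω' h
  simp only [mem_preimage, mem_setOf_eq, true_iff] at key
  exact key.symm

/-- Hence the dual open graphs agree on a dual-vertex set `A` when the configurations agree on `dualEdge ⁻¹' A.sym2`. -/
theorem openGraph_dualConfig_adj_congr {ω ω' : BondConfig (Site 2)} {A : Set (Site 2)} {K : Set (Sym2 (Site 2))}
    (hK : dualEdge ⁻¹' A.sym2 ⊆ K) (h : ω ∩ K = ω' ∩ K) :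
    ∀ a ∈ A, ∀ b ∈ A, ((openGraph (dualConfig ω)).Adj a b ↔ (openGraph (dualConfig ω')).Adj a b) :=
  fun a ha b hb ↦ openGraph_adj_congr_of_inter_eq Subset.rfl
    (dualConfig_inter_eq_of_inter_preimage_eq (inter_eq_inter_of_subset h hK)) a b ha hb

end Geometry

/-! ## §2 All exterior objects agree -/

section Exterior

variable (sc : Site 2 → ℕ) (X : Set (Site 2))

variable {sc X} in
/-- Interiors of selected regions lie in `zInteriors`, dual interiors in `zDualInteriors`. -/
theorem zBall_subset_zInteriors {ω : BondConfig (Site 2)} {x : Site 2} (hx : x ∈ zSel sc X ω) :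
    zBall x (sc x) ⊆ zInteriors sc X ω ∧ zDualBall x (sc x) ⊆ zDualInteriors sc X ω :=
  ⟨subset_biUnion_of_mem (u := fun y ↦ zBall y (sc y)) hx, subset_biUnion_of_mem (u := fun y ↦ zDualBall y (sc y)) hx⟩

/-- **All exterior objects agree on `ℤ²`.**  If `ω`, `ω'` agree on the exterior pairs of `Λ_{sc x}(x)` and the enlarged
closed collars of the other candidate centres avoid `Λ_{sc x + 1}(x)`, then the selected sets agree, the realised states
agree off `x`, and if `x` is selected both glued partitions agree for every state vector. -/
theorem exterior_agree_z2 {x : Site 2} (hX : ∀ y ∈ X, y ≠ x → Disjoint (zBall y (2 * sc y + 1)) (zBall x (sc x + 1)))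
    {ω ω' : BondConfig (Site 2)} (h : ω ∩ zExtEdges x (sc x) = ω' ∩ zExtEdges x (sc x)) :
    zSel sc X ω = zSel sc X ω' ∧ (∀ y ≠ x, zState sc X ω y = zState sc X ω' y) ∧
      (x ∈ zSel sc X ω → ∀ b, zGlueP sc X ω b = zGlueP sc X ω' b ∧ zGlueD sc X ω b = zGlueD sc X ω' b) := by
  -- geometry: the big (dual) balls of `y ≠ x`, and the (dual) collar of `x`, avoid the (dual) box of `x`
  have hbig : ∀ y ∈ X, y ≠ x → Disjoint (zBall y (2 * sc y)) (zBall x (sc x)) := fun y hy hyx ↦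
    (hX y hy hyx).mono (zBall_mono y (by omega)) (zBall_mono x (by omega))
  have hbigD : ∀ y ∈ X, y ≠ x → Disjoint (zDualBall y (2 * sc y)) (zDualBall x (sc x)) := fun y hy hyx ↦
    (hX y hy hyx).mono (zDualBall_subset_zBall_succ y _) (zDualBall_subset_zBall_succ x _)
  have hcol : ∀ y ∈ X, Disjoint (zBall y (2 * sc y) \ zBall y (sc y)) (zBall x (sc x)) := by
    intro y hy
    by_cases hyx : y = x
    · subst hyx; exact disjoint_sdiff_left
    · exact (hbig y hy hyx).mono_left sdiff_subset
  have hcolD : ∀ y ∈ X, Disjoint (zDualBall y (2 * sc y) \ zDualBall y (sc y)) (zDualBall x (sc x)) := by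
    intro y hy
    by_cases hyx : y = x
    · subst hyx; exact disjoint_sdiff_left
    · exact (hbigD y hy hyx).mono_left sdiff_subset
  -- selection
  have hsel : zSel sc X ω = zSel sc X ω' := by
    ext y
    suffices key : y ∈ X → (ω ∈ ZFourStrands y (sc y) ↔ ω' ∈ ZFourStrands y (sc y)) by
      exact ⟨fun hy ↦ ⟨hy.1, (key hy.1).1 hy.2⟩, fun hy ↦ ⟨hy.1, (key hy.1).2 hy.2⟩⟩
    intro hy
    refine (determinedBy_iff _ _).1 ((zFourStrands_determinedBy_pairs y (sc y)).mono ?_) ω ω' h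
    exact union_subset (sym2_subset_zExtEdges_of_disjoint (hcol y hy))
      (preimage_dualEdge_sym2_subset_zExtEdges (hcolD y hy))
  -- states off `x`
  have hstate : ∀ y ≠ x, zState sc X ω y = zState sc X ω' y := by
    intro y hyx
    by_cases hy : y ∈ X
    · have hhook : ω ∈ ZHookR y (sc y) ↔ ω' ∈ ZHookR y (sc y) :=
        (determinedBy_iff _ _).1 ((zHookR_determinedBy y (sc y)).mono
          (sym2_subset_zExtEdges_of_disjoint (hbig y hy hyx))) ω ω' h
      rw [Bool.eq_iff_iff]
      simp only [zState, decide_eq_true_eq, hsel, hhook]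
    · have h1 : y ∉ zSel sc X ω := fun hh ↦ hy hh.1
      have h2 : y ∉ zSel sc X ω' := fun hh ↦ hy hh.1
      simp only [zState, h1, h2, false_and, decide_false]
  refine ⟨hsel, hstate, fun hx b ↦ ?_⟩
  -- germs read only the (dual) collar pairs
  have hgermP : ∀ y ∈ zSel sc X ω, ∀ v, ZGermP sc ω y v ↔ ZGermP sc ω' y v := fun y hy v ↦
    isCrossing_congr (zdGraph 2) (fun a ha c hc ↦ openGraph_adj_congr_of_inter_eq Subset.rfl
      (inter_eq_inter_of_subset h (sym2_subset_zExtEdges_of_disjoint (hcol y hy.1))) a c ha hc) v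
  have hgermD : ∀ y ∈ zSel sc X ω, ∀ v, ZGermD sc ω y v ↔ ZGermD sc ω' y v := fun y hy v ↦
    isCrossing_congr (zdGraph 2)
      (openGraph_dualConfig_adj_congr (preimage_dualEdge_sym2_subset_zExtEdges (hcolD y hy.1)) h) v
  -- blob steps read only pairs off the (dual) interiors, which contain the (dual) box of `x`
  obtain ⟨hI, hID⟩ := zBall_subset_zInteriors hx
  have hpathP : ∀ v w, PathIn (openGraph ω) (zInteriors sc X ω)ᶜ v w ↔ PathIn (openGraph ω') (zInteriors sc X ω)ᶜ v w :=
    fun v w ↦ pathIn_congr_of_adj_iff (fun a ha c hc ↦ openGraph_adj_congr_of_inter_eq Subset.rfl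
      (inter_eq_inter_of_subset h (sym2_subset_zExtEdges_of_disjoint
        (disjoint_compl_left.mono_right hI))) a c ha hc) v w
  have hpathD : ∀ v w, PathIn (openGraph (dualConfig ω)) (zDualInteriors sc X ω)ᶜ v w ↔
      PathIn (openGraph (dualConfig ω')) (zDualInteriors sc X ω)ᶜ v w := fun v w ↦
    pathIn_congr_of_adj_iff (openGraph_dualConfig_adj_congr
      (preimage_dualEdge_sym2_subset_zExtEdges (disjoint_compl_left.mono_right hID)) h) v w
  have hint : zInteriors sc X ω' = zInteriors sc X ω := by simp only [zInteriors, hsel]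
  have hintD : zDualInteriors sc X ω' = zDualInteriors sc X ω := by simp only [zDualInteriors, hsel]
  constructor
  · unfold zGlueP
    congr 1
    ext v w
    rw [hpathP, hint, ← hsel]
    constructor
    · rintro (h1 | ⟨y, hy, hb, hv, hw⟩)
      · exact Or.inl h1
      · exact Or.inr ⟨y, hy, hb, (hgermP y hy v).1 hv, (hgermP y hy w).1 hw⟩
    · rintro (h1 | ⟨y, hy, hb, hv, hw⟩)
      · exact Or.inl h1
      · exact Or.inr ⟨y, hy, hb, (hgermP y hy v).2 hv, (hgermP y hy w).2 hw⟩
  · unfold zGlueD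
    congr 1
    ext v w
    rw [hpathD, hintD, ← hsel]
    constructor
    · rintro (h1 | ⟨y, hy, hb, hv, hw⟩)
      · exact Or.inl h1
      · exact Or.inr ⟨y, hy, hb, (hgermD y hy v).1 hv, (hgermD y hy w).1 hw⟩
    · rintro (h1 | ⟨y, hy, hb, hv, hw⟩)
      · exact Or.inl h1
      · exact Or.inr ⟨y, hy, hb, (hgermD y hy v).2 hv, (hgermD y hy w).2 hw⟩

end Exterior

/-! ## §3 Pinned unambiguity on `ℤ²` is exterior-determined -/

section Pinned

/-- **Registered anchor: pinned unambiguity is exterior-determined on `ℤ²`.**  If the enlarged closed collars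
`Λ_{2 sc y + 1}(y)` of the candidate centres `y ≠ x` avoid `Λ_{sc x + 1}(x)`, then for each pinned value `β` the event
"`x` is selected and unambiguous if its state is `β`" is determined by the pairs with no endpoint in `Λ_{sc x}(x)`. -/
theorem zUnambiguousIf_determinedBy : ∀ (sc : Site 2 → ℕ) (X : Set (Site 2)) (x : Site 2), (∀ y ∈ X, y ≠ x → Disjoint (zBall y (2 * sc y + 1)) (zBall x (sc x + 1))) → ∀ β : Bool, DeterminedBy {ω | x ∈ Summit.CriticalPhenomena.CardyFormulaZ2.Cruxes.NestingRigidity.PinchResampling.zSel sc X ω ∧ Summit.CriticalPhenomena.CardyFormulaZ2.Cruxes.NestingRigidity.PinchResampling.ZUnambiguousIf sc X ω x β} (zExtEdges x (sc x)) := by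
  intro sc X x hX β
  rw [determinedBy_iff]
  intro ω ω' h
  obtain ⟨hsel, hstate, hglue⟩ := exterior_agree_z2 sc X hX h
  have hupd : Function.update (zState sc X ω) x β = Function.update (zState sc X ω') x β := by
    funext y
    by_cases hyx : y = x
    · subst hyx
      simp
    · simp [Function.update_of_ne hyx, hstate y hyx]
  simp only [mem_setOf_eq]
  constructor
  · rintro ⟨hx, hU⟩
    refine ⟨hsel ▸ hx, fun b hb ↦ hU b ?_⟩
    obtain ⟨hb1, hb2, hb3⟩ := hb
    refine ⟨fun y hy ↦ hb1 y (hsel ▸ hy), ?_, ?_⟩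
    · rw [(hglue hx b).1, (hglue hx _).1, hupd]; exact hb2
    · rw [(hglue hx b).2, (hglue hx _).2, hupd]; exact hb3
  · rintro ⟨hx, hU⟩
    have hx' : x ∈ zSel sc X ω := hsel ▸ hx
    refine ⟨hx', fun b hb ↦ hU b ?_⟩
    obtain ⟨hb1, hb2, hb3⟩ := hb
    refine ⟨fun y hy ↦ hb1 y (hsel ▸ hy), ?_, ?_⟩
    · rw [← (hglue hx' b).1, ← hupd, ← (hglue hx' _).1]; exact hb2
    · rw [← (hglue hx' b).2, ← hupd, ← (hglue hx' _).2]; exact hb3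

/-- Corollary: the unpinned event splits along the realised state (as on `𝕋`). -/
theorem zSel_and_zUnambiguous_iff (sc : Site 2 → ℕ) (X : Set (Site 2)) (ω : BondConfig (Site 2)) (x : Site 2) :
    (x ∈ zSel sc X ω ∧ ZUnambiguous sc X ω x) ↔
      (x ∈ zSel sc X ω ∧ ω ∈ ZHookR x (sc x) ∧ ZUnambiguousIf sc X ω x true) ∨
        (x ∈ zSel sc X ω ∧ ω ∉ ZHookR x (sc x) ∧ ZUnambiguousIf sc X ω x false) := by
  rw [zUnambiguous_iff_zUnambiguousIf]
  by_cases hx : x ∈ zSel sc X ω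
  · by_cases hh : ω ∈ ZHookR x (sc x)
    · simp [zState, hx, hh]
    · simp [zState, hx, hh]
  · simp [hx]

end Pinned

end Summit.CriticalPhenomena.CardyFormulaZ2.Cruxes.NestingRigidity.PinchResampling

end
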